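import Summits.CriticalPhenomena.PercolationContinuityZ3.Theorems.PercNearOneGluingNoHeavyQuantFarSunCertTenTwoD
import Summits.CriticalPhenomena.PercolationContinuityZ3.Theorems.PercNearOneGluingNoHeavyQuantFarSunCertTenThreeC
import Summits.CriticalPhenomena.PercolationContinuityZ3.Theorems.PercNearOneGluingNoHeavyQuantFarSunCertTenFourC
import Summits.CriticalPhenomena.PercolationContinuityZ3.Theorems.PercNearOneGluingNoHeavyQuantFarSunRowLeNine
import HarnessLib

/-!
# FAR beyond trees: **`HairyCycle.SunFAR K j` for every `K ≤ 10` and every layer `j`**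

builds on p205010 (kernel theorem, internal audit signed; external expert review pending)

Support file (`--supports stmt-CriticalPhenomena-4575`), seat `prim-cert-1` (gen 30); memos `prim-cert-1/FROM-prim-cert-1-g26-CONFIG-CERTS.md`,
`prim-cert-1/FROM-prim-cert-1-g28-TOP-LAYERS.md`, `prim-cert-1/FROM-prim-cert-1-g30-SUPPORT-LEMMA.md`.
The middle layers of `K = 10` are the Kronecker-checked certificates `sunFAR_ten_two` (`…QuantFarSunCertTenTwoD`), `sunFAR_ten_three`
(`…QuantFarSunCertTenThreeC`) and `sunFAR_ten_four` (`…QuantFarSunCertTenFourC`, kit j184881, denominator 6); the other layers are generic (`sunFAR_all_of_middle`, `…QuantFarSunLayers`).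
* `HairyCycle.sunFAR_ten` — `SunFAR 10 j` for every `j`;
* **`HairyCycle.sunFAR_of_le_ten`** — `SunFAR K j` for `2 ≤ K ≤ 10`, every `j`;
* `HairyCycle.farRelayRow_hairyCycle_of_le_ten` — `Quant.FarRelayRow`'s body at every layer on every hairy cycle with `K ≤ 10` pendant relays.
No sorries; the computational content (`native_decide`) lives in the certificate files.  [this work]
-/

namespace Summit.CriticalPhenomena.PercolationContinuityZ3.Theorems.HairyCycle

open Finset MeasureTheory
open Literature.Probability.Percolation Literature.Probability.LatticeModels
open Summit.CriticalPhenomena.PercolationContinuityZ3.Theorems.TwoCopy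
open scoped Classical

/-- **`SunFAR 10 j` for every layer `j`.** [this work] -/
theorem sunFAR_ten (j : ℕ) : SunFAR 10 j := by
  refine sunFAR_all_of_middle (by norm_num) (fun j hj2 hjK => ?_) j
  have hj4 : j ≤ 4 := by omega
  interval_cases j
  · exact sunFAR_ten_two
  · exact sunFAR_ten_three
  · exact sunFAR_ten_four

/-- **`SunFAR K j` for `2 ≤ K ≤ 10` and every layer `j`.** [this work] -/
theorem sunFAR_of_le_ten {K : ℕ} (hK2 : 2 ≤ K) (hK : K ≤ 10) (j : ℕ) : SunFAR K j := by
  rcases Nat.lt_or_ge K 10 with h | h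
  · exact sunFAR_of_le_nine hK2 (by omega) j
  · obtain rfl : K = 10 := le_antisymm hK h
    exact sunFAR_ten j

/-- **FAR (`Quant.FarRelayRow`'s body) at every layer on every hairy cycle with `K ≤ 10` pendant relays**, all weights. [this work] -/
theorem farRelayRow_hairyCycle_of_le_ten {n L K : ℕ} {cyc : ℕ → Fin n} {base : ℕ → ℕ} {tip : ℕ → Fin n} (H : IsHairyCycle L cyc K base tip)
    (hK2 : 2 ≤ K) (hK : K ≤ 10) (w : Sym2 (Fin n) → unitInterval)
    (hsupp : ∀ e : Sym2 (Fin n), ¬ e.IsDiag → w e ≠ 0 →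
      (∃ i, i < L ∧ e = cycE L cyc i) ∨ (∃ k, k < K ∧ e = hairE cyc base tip k))
    (j : ℕ) (t : ℝ)
    (hEN : (2 * j : ℝ) < ∑ a ∈ (Finset.range K).image tip, (prodBernoulli w).real (openConn (cyc 0) a))
    (hcut : ∀ a ∈ (Finset.range K).image tip, (prodBernoulli w).real (openConn (cyc 0) a)ᶜ ≤ t) :
    (prodBernoulli w).real {ω : BondConfig (Fin n) |
      (((Finset.range K).image tip).filter fun a => ω ∈ openConn (cyc 0) a).card ≤ j} ≤ t :=
  farRelayRow_hairyCycle_of_forall_sunFAR H (sunFAR_of_le_ten hK2 hK) w hsupp j t hEN hcut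

end Summit.CriticalPhenomena.PercolationContinuityZ3.Theorems.HairyCycle
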